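import Literature.MathematicalPhysics.QuantumFieldTheory.Balaban1983to89.Node00.N24KnitStage12N09
import Literature.MathematicalPhysics.QuantumFieldTheory.Balaban1983to89.B16NodeKnitRecord12

/-!
# NODE N24 · (B2) AND CRUX K1′'s STUB BODIES AT NODE 00's STAGE-12 RECORD WITH EVERY STAGE-12-NATIVE CHILD ENTERED BY NAME — N09 (`B12NodeKnitRecord12`, module 28a), N11
# (seat dag-n11-e's `B14NodeKnitRecord12R`), AND NOW N13 (`B16NodeKnitRecord12`, module 30: [Balaban1989LargeFieldII] Thm 1 + (0.1) at the record's objects): the last WORLD-LEVEL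
# hypotheses `hR` + `hcor3` of modules 23 ∕ 24 ∕ 26 ∕ 27 ∕ 28b become the θ-KEYED slot pair (R₁₂) + (UV₁₂) — NO WORLD-LEVEL NODE HYPOTHESIS IS LEFT in N24's Stage-12 knit

TRACK A (YM-PLAN §2d, node N24 of 28 = binder B2 `hB : B16.EndStatementBPrinted D.C`), seat `pub-ymgap-dag-n24-c` (R134 fan-out seat, strategy s2; gen 3; g2 HANDOFF trigger (t2)
«n13's ₁₂ junction ⇒ replace `hR` + `hcor3` in 28b ∕ 29»).  THIRTY-FIRST N24 module, a NEW importing one (modules 1–30 untouched; imports module 28b `N24KnitStage12N09` and module 30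
`B16NodeKnitRecord12`).  THEOREMS ONLY, def-free, sorry-free, standard axioms.  = module 19 `N24KnitStage10C` §1 (every child at θ₁₀ by name) re-keyed ₁₀ ↦ ₁₂, in the two record-level
currencies at ₁₂: (B2) over a given record (modules 23 ∕ 24 ∕ 28b) and the thirteen-node conjunction (modules 26 ∕ 28b); the closer's pointed form follows in module 32.

N13 BY NAME.  [Balaban1989LargeFieldII]'s node `Dag.B16_main` = «in-edges → (𝐑 holds) ∧ ((interval ⇒ §2 description) ⇒ (interval ⇒ (0.1)))».  At a world bound to the Stage-12
construction it follows (module 30's `b16_main_at_record₁₂` ∕ `b16_main_of_isRecordOfRecord₁₂C`, dag-n13-a's module 13 engine at `coreOfRecord₁₂`) from N13's two OWN products AT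
THE OBJECTS OF RECORD: **(R₁₂)** `∀ k < K, TLaw₁₂ θ P k → SLaw₁₂ θ P (k+1)` — 𝐑 carries the repaired 𝐓-image form of `𝐓ρ_k` of record into the repaired §2 form of `ρ_{k+1}`
([V] Thm 1 for 𝐑; IS the record's 𝐑-leaf `ROpLeaf (VOfRecord₁₂ θ P)`, def-T's `rOpLeaf_VOfRecord₁₂_iff`) — and **(UV₁₂)** «interval on `]0, w.γ]` ⇒ ∀ k ≤ K, `SLaw₁₂ θ P k` ⇒ (0.1)
POINTWISE on `densOfRecord₁₀ θ.toStage9Params P k` with `χ = chiFixed7 θ.ν`, `A^η = wilsonBGOfRecord θ.εbg`, `g_k = gOfRecord₁₀ θ.toStage9Params P k`, `e∓ = w.em ∕ w.ep`» (Cor. 3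
pp. 387 ∕ 391).  So `hR : ∀ P, (w.up P).rOperation` (world-level) and `hcor3 : ∃ (e₋, e₊) R, the five [III] Cor.-3 leaves at (D.C, w.γ)` become ONE θ-KEYED BINDER `slots₁₃` (the pair),
exactly as at ₁₀ (module 19's `slots₁₁₁₃`, whose (S0) ∕ (S1ᵀ) halves are now `sLaw₁₂_zero` ∕ `slot11`).  Because (UV₁₂) is read AT THE WORLD'S OWN `(e₋, e₊)`, the thirteen-node
conjunction now holds AT `w` ITSELF (§2) — module 26 ∕ 28b's «∃ (e₋, e₊), … { w with em, ep }» re-reading is gone.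

WHAT THIS FILE PROVES.
§0 `N24_b16_main_of_isRecordOfRecord₁₂C_of_slots` — N13 at every run of a ₁₂C record from the keyed pair (module 30, by name).
§1 **`N24_at_record₁₂C_knit_all_pinned`** — (B2) at a ₁₂C record, EVERY child by name (module 23's engine `N24_at_record₁₂C`: N05 ∕ N06 ∕ N07 ∕ N08 ∕ N10 ∕ N12 from the θ-keyed
   sockets, N09 ← module 28b §0, N11 ← module 24 §0, N13 ← §0); `N24_at_record₁₂C_knit_all_of_betaMerged_pinned` (β read at the merged β: EVERY hypothesis θ-keyed);
   **`N24_stabilityBR12e_thetaShape15_knit_all_pinned`** — K1′'s rev-15 consequent shape (guard displayed).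
§2 **`N24_nodes₁₂C_knit_all_pinned`** — `∀ P, Nodes (leavesP w P)` AT THE RECORD'S OWN WORLD (no exponent re-read); `N24_nodesAtRecord₁₂_thetaShape_knit_all_pinned` (witness `w` itself).
The closer's POINTED forms with every child at θ's objects (modules 27 ∕ 28b's `…_pointed(_N09)` family with `hcor3` ↦ (UV₁₂)) are the sequel `Node00/N24NodesStage12PointedAll` (module 32);
the four-pin carrier-chain forms (modules 25 ∕ 29) the sequel `Node00/N24KnitStage12CarriersAll` (module 33).

WHICH CHILD BLOCKS AT ₁₂ AFTER THIS FILE (kernel form = the hypothesis lists below): THEOREMS — N01 N02 N03 N04, the guarded (0.20), the start (S0), window ∕ interval packaging;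
BY NAME through their junctions — N09 (own Lemma-4 leaf `slot12` + [B11] Thm 1 ×3 `h11dom` ∕ `hres` ∕ `huniq`), N11 ((S1ᵀ) `slot11`), N13 ((R₁₂) + (UV₁₂) `slots₁₃`); six residual-carrier
leaves (N05 [B8] · N06 def-Y · N07 [B11] · N08 leaf systems · N10 B13 socket · N12 [IV]); β-box pair (β⁺ [I] (1.22) p. 264; `b > 0` NODE O, UNPRINTED); inhabitation + guard
`θ.ZtUnity ∧ θ.SlotsNondegenerate` + `Provisos₁₂ ∧ Admissible` = K0′ `Record12Inhabited` (stmt-QuantumFields-19902).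
HONEST FRAMING: kernel bookkeeping BY NAME; nothing of Bałaban's asserted; every slot DISPLAYED; N24 COMPOSITE — no discharge, no count, no stub closed; one finite T⁴ programme at
fixed ε; NOT continuum ∕ ℝ⁴ ∕ OS ∕ mass gap ∕ Clay.
-/

noncomputable section

open scoped Matrix.Norms.L2Operator

namespace Literature.MathematicalPhysics.QuantumFieldTheory.Balaban1983to89.Node00

open DagBinding T4Continuum T4DatumAssembly FlowStepRuns AveragingRT
open FlowStep (BetaLowerH BetaUpperH)

variable {F : T4Family} {N : ℕ} [NeZero N] {D : FiniteEpsData F (SU N)} {w : WorldP}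

/-! ## §0. N13 at every run of a Stage-12 record from the θ-keyed slot pair (R₁₂) + (UV₁₂) (module 30's junction, by name) -/

/-- **N13 · [Balaban1989LargeFieldII] AT EVERY RUN OF A STAGE-12 RECORD, BY NAME** — `B16NodeKnitRecord12.b16_main_of_isRecordOfRecord₁₂C`: for every presentation `(θ, hP)` binding
the world, at every run `P`, (R₁₂) law transport by 𝐑 along the tower of record `∀ k < K, TLaw₁₂ θ P k → SLaw₁₂ θ P (k+1)` and (UV₁₂) (0.1) pointwise on `densOfRecord₁₀ θ.toStage9Params P k`
for repaired-§2-format levels under the interval hypothesis on `]0, w.γ]`, with the world's own exponent functions. [cite: Balaban1989LargeFieldII, Thm 1 p.355, (0.1) pp.355–356, p.387, p.391; Balaban1988Convergent, p.244, (2.18) p.257, Cor. 3 (2.50) p.264 (node bookkeeping at the Stage-12 record)] -/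
theorem N24_b16_main_of_isRecordOfRecord₁₂C_of_slots (h : IsRecordOfRecord₁₂C F N D w)
    (slots₁₃ : ∀ (θ : Stage12Params F N) (hP : θ.Provisos₁₂ F N), θ.Admissible F N → D = datumOfRecord₁₂ F N θ hP →
      (∀ P, w.up P = upOfRecord₅C F N (θ.toStage5₁₂ F N) P) → ∀ P : B12.RunParams,
        (∀ k, k < P.K → TLaw₁₂ F N θ P k → SLaw₁₂ F N θ P (k + 1)) ∧
        ((genFlow (betaOfRecord₁₀ F N θ.toStage9Params) P.g0).InInterval w.γ P.K → ∀ k, k ≤ P.K → SLaw₁₂ F N θ P k →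
          ∀ U : GaugeField (F.P P.K) k (SU N),
            chiFixed7 F N θ.ν P.K (gOfRecord₁₀ F N θ.toStage9Params P) k U *
                  Real.exp (-(1 / (gOfRecord₁₀ F N θ.toStage9Params P k) ^ 2 * wilsonBGOfRecord F N θ.εbg P k U)
                    - w.em (gOfRecord₁₀ F N θ.toStage9Params P k) * (Fintype.card (Site (F.P P.K) k) : ℝ)) ≤ densOfRecord₁₀ F N θ.toStage9Params P k U ∧
            densOfRecord₁₀ F N θ.toStage9Params P k U ≤ Real.exp (w.ep (gOfRecord₁₀ F N θ.toStage9Params P k) * (Fintype.card (Site (F.P P.K) k) : ℝ))))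
    (P : B12.RunParams) : Dag.B16_main (leavesP w P) :=
  B16NodeKnitRecord12.b16_main_of_isRecordOfRecord₁₂C h slots₁₃ P

/-! ## §1. (B2) and K1′'s consequent shape at a Stage-12 record, EVERY child by name -/

/-- **N24 · (B2) AT THE STAGE-12 RECORD, EVERY PAPER CHILD ENTERED AT THE RECORD'S OWN PARAMETERS BY NAME** (module 28b's `N24_at_record₁₂C_knit_N09_N11_pinned` with the world-level
pair `hR` + `hcor3` replaced by §0): N01 N02 N03 N04 theorems (inside module 23's engine `N24_at_record₁₂C`); six θ-keyed residual-carrier sockets (X-[B8] N05 ∕ Y N06 ∕ Z N07 ∕ X-[B10]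
N08 ∕ X-B13 N10 ∕ W N12, module 23 §0); **N09** ← own leaf `slot12` + [Balaban1985Variational] Thm 1 ×3 (`h11dom`, `hres`, `huniq`) — `B12NodeKnitRecord12`; **N11** ← (S1ᵀ) `slot11` —
seat dag-n11-e's `B14NodeKnitRecord12R`; **N13** ← (R₁₂) + (UV₁₂) `slots₁₃` — `B16NodeKnitRecord12`; β-box on `D.βfun` over `]0, γ₀]`.  THE HYPOTHESIS LIST IS «WHICH CHILD BLOCKS AT
₁₂C» WITH NO WORLD-LEVEL NODE HYPOTHESIS. [cite: Balaban1989LargeFieldII, Thm 1 p.355, (0.1) pp.355–356, p.387, p.391; Balaban1988Convergent, Thm 1 p.262, Theorem p.245, p.244, (2.18) p.257, Cor. 3 (2.50) p.264; Balaban1987RG1, Thm 1 p.259, Thm 3 p.264, Lemma 4 (3.53) p.280, (1.1)–(1.3) p.260, (1.22) p.264; Balaban1985Variational, Thm 1 (8)–(10) p.279; Balaban1985RegularSpaces, Thms 2, 4, 8 pp.83–101; Balaban1985BackgroundPropagators, Thms 3.1–3.15 pp.397–432; Balaban1985UV3, Thm 1 p.257 + Thm 2 p.272; Balaban1988RG2Cluster,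 Lemmas 1–3 pp.9, 11, 20; Balaban1989LargeFieldI, Prop. 1 p.194; Balaban1984PropagatorsII, pp.234–249 (bookkeeping over the Stage-12 record)] -/
theorem N24_at_record₁₂C_knit_all_pinned (h : IsRecordOfRecord₁₂C F N D w) {γ₀ : ℝ} (hγ₀ : w.γ ≤ γ₀)
    (slots₀₅ : ∀ (θ : Stage12Params F N) (hP : θ.Provisos₁₂ F N), θ.Admissible F N → D = datumOfRecord₁₂ F N θ hP →
      (∀ P, w.up P = upOfRecord₅C F N (θ.toStage5₁₂ F N) P) → ∀ P : B12.RunParams,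
        B8LeafR (θ.res.X P).d8 (θ.res.X P).L8 (θ.res.X P).C₂ (θ.res.X P).B₁' (θ.res.X P).B₀' (θ.res.X P).B₁ (θ.res.X P).B₂ (θ.res.X P).c₁
          (θ.res.X P).inp8 (θ.res.X P).B₀β (θ.res.X P).loc8 (θ.res.X P).fam8R (θ.res.X P).lan8 (θ.res.X P).cub8 (θ.res.X P).toAxial8)
    (slots₀₆ : ∀ (θ : Stage12Params F N) (hP : θ.Provisos₁₂ F N), θ.Admissible F N → D = datumOfRecord₁₂ F N θ hP →
      (∀ P, w.up P = upOfRecord₅C F N (θ.toStage5₁₂ F N) P) → ∀ P : B12.RunParams, B9LeafX (θ.res.Y P))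
    (slots₀₇ : ∀ (θ : Stage12Params F N) (hP : θ.Provisos₁₂ F N), θ.Admissible F N → D = datumOfRecord₁₂ F N θ hP →
      (∀ P, w.up P = upOfRecord₅C F N (θ.toStage5₁₂ F N) P) → ∀ P : B12.RunParams, B11Leaf (θ.res.Z P))
    (slots₀₈ : ∀ (θ : Stage12Params F N) (hP : θ.Provisos₁₂ F N), θ.Admissible F N → D = datumOfRecord₁₂ F N θ hP →
      (∀ P, w.up P = upOfRecord₅C F N (θ.toStage5₁₂ F N) P) → ∀ P : B12.RunParams,
        ∃ (Xc : PrintedCarriersR) (I : Type) (C : B10Assembly.Consts) (T : I → B10.TowerRun),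
          Nonempty (∀ i, B10Assembly.LeafSystem C (T i)) ∧ θ.res.X P = Xc.withTowerRuns10 T)
    (slot12 : ∀ (θ : Stage12Params F N) (hP : θ.Provisos₁₂ F N), θ.Admissible F N → D = datumOfRecord₁₂ F N θ hP → w.γ ≤ θ.γ →
      (∀ P, w.up P = upOfRecord₅C F N (θ.toStage5₁₂ F N) P) → ∀ P : B12.RunParams, B12Sec2to5.Lemma4Printed (θ.res.X P).F12 (θ.res.X P).c12)
    (h11dom : ∀ (θ : Stage12Params F N) (hP : θ.Provisos₁₂ F N), θ.Admissible F N → D = datumOfRecord₁₂ F N θ hP → w.γ ≤ θ.γ →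
      ∀ (p : B12.RunParams) (k : ℕ), k ≤ p.K →
        ∀ V ∈ domAltOfRecord F N θ.ν p.K k, UkExists F N p.K k θ.εbg V ∧ UniqueUkOrbit F N p.K k θ.εbg V)
    (hres : ∀ (θ : Stage12Params F N) (hP : θ.Provisos₁₂ F N), θ.Admissible F N → D = datumOfRecord₁₂ F N θ hP → w.γ ≤ θ.γ →
      ∀ (p : B12.RunParams) (k : ℕ), k ≤ p.K → HRestrict F N θ.εbg p.K k (domAltOfRecord F N θ.ν p.K k))
    (huniq : ∀ (θ : Stage12Params F N) (hP : θ.Provisos₁₂ F N), θ.Admissible F N → D = datumOfRecord₁₂ F N θ hP → w.γ ≤ θ.γ →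
      ∀ (p : B12.RunParams) (k : ℕ), k ≤ p.K → ∀ V ∈ domAltOfRecord F N θ.ν p.K k, ∀ j < k,
        UniqueUkOrbit F N p.K (j + 1) θ.εbg (Averaging.iter (avOfRecord F N p.K) (j + 1) (Uk F N p.K k θ.εbg V)))
    (slots₁₀ : ∀ (θ : Stage12Params F N) (hP : θ.Provisos₁₂ F N), θ.Admissible F N → D = datumOfRecord₁₂ F N θ hP →
      (∀ P, w.up P = upOfRecord₅C F N (θ.toStage5₁₂ F N) P) → ∀ P : B12.RunParams,
        B9LeafX (θ.res.Y P) →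
          (B10.Thm1PrintedCompact (θ.res.X P).runs10 ∧ B10.Thm2Printed (θ.res.X P).runs10) →
            B11Leaf (θ.res.Z P) → B12Sec2to5.Lemma4Printed (θ.res.X P).F12 (θ.res.X P).c12 →
              B13.Lemma1Printed (θ.res.X P).S13 (θ.res.X P).c13 ∧ B13.Lemma2Printed (θ.res.X P).S13 (θ.res.X P).c13 ∧
                B13.Lemma3Printed (θ.res.X P).S13 (θ.res.X P).c13)
    (slot11 : ∀ (θ : Stage12Params F N) (hP : θ.Provisos₁₂ F N), θ.Admissible F N → D = datumOfRecord₁₂ F N θ hP →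
      (∀ P, w.up P = upOfRecord₅C F N (θ.toStage5₁₂ F N) P) → ∀ P : B12.RunParams,
        (leavesP w P).b7 → (leavesP w P).b8 → (leavesP w P).b9 → (leavesP w P).b10 → (leavesP w P).b11 →
          (leavesP w P).smallCouplings → (leavesP w P).smallFieldInductive → (leavesP w P).flowControl →
            ∀ k, k < P.K → SLaw₁₂ F N θ P k → TLaw₁₂ F N θ P k)
    (slots₁₂ : ∀ (θ : Stage12Params F N) (hP : θ.Provisos₁₂ F N), θ.Admissible F N → D = datumOfRecord₁₂ F N θ hP →
      (∀ P, w.up P = upOfRecord₅C F N (θ.toStage5₁₂ F N) P) → ∀ P : B12.RunParams, B15Leaf (θ.res.W P))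
    (slots₁₃ : ∀ (θ : Stage12Params F N) (hP : θ.Provisos₁₂ F N), θ.Admissible F N → D = datumOfRecord₁₂ F N θ hP →
      (∀ P, w.up P = upOfRecord₅C F N (θ.toStage5₁₂ F N) P) → ∀ P : B12.RunParams,
        (∀ k, k < P.K → TLaw₁₂ F N θ P k → SLaw₁₂ F N θ P (k + 1)) ∧
        ((genFlow (betaOfRecord₁₀ F N θ.toStage9Params) P.g0).InInterval w.γ P.K → ∀ k, k ≤ P.K → SLaw₁₂ F N θ P k →
          ∀ U : GaugeField (F.P P.K) k (SU N),
            chiFixed7 F N θ.ν P.K (gOfRecord₁₀ F N θ.toStage9Params P) k U *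
                  Real.exp (-(1 / (gOfRecord₁₀ F N θ.toStage9Params P k) ^ 2 * wilsonBGOfRecord F N θ.εbg P k U)
                    - w.em (gOfRecord₁₀ F N θ.toStage9Params P k) * (Fintype.card (Site (F.P P.K) k) : ℝ)) ≤ densOfRecord₁₀ F N θ.toStage9Params P k U ∧
            densOfRecord₁₀ F N θ.toStage9Params P k U ≤ Real.exp (w.ep (gOfRecord₁₀ F N θ.toStage9Params P k) * (Fintype.card (Site (F.P P.K) k) : ℝ))))
    (hlo : BetaLowerH w.b γ₀ D.βfun) (hhi : BetaUpperH w.βup γ₀ D.βfun) :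
    B16.EndStatementBPrinted D.C :=
  N24_at_record₁₂C h hγ₀ (N24_b8_main_of_isRecordOfRecord₁₂C_of_slot h slots₀₅) (N24_b9_main_of_isRecordOfRecord₁₂C_of_slot h slots₀₆)
    (N24_b11_main_of_isRecordOfRecord₁₂C_of_slot h slots₀₇) (N24_b10_main_of_isRecordOfRecord₁₂C_of_slot h slots₀₈)
    (N24_b12_main_of_isRecordOfRecord₁₂C_of_slots h slot12 h11dom hres huniq) (N24_b13_main_of_isRecordOfRecord₁₂C_of_slot h slots₁₀)
    (N24_b14_main_of_isRecordOfRecord₁₂C_of_slot h slot11) (N24_b15_main_of_isRecordOfRecord₁₂C_of_slot h slots₁₂)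
    (N24_b16_main_of_isRecordOfRecord₁₂C_of_slots h slots₁₃) hlo hhi

/-- **The same with the β-binders READ AT THE MERGED β over `mergedTermFamilyMatT (TcOfRecord) (chiFixed7 θ.ν)` along the world's own box `]0, w.γ]^{k+1}`** (module 23's
`N24_betaLowerH_iff_merged₁₂` ∕ `N24_betaUpperH_iff_merged₁₂` at the presenting `θ`): NOW EVERY HYPOTHESIS IS θ-KEYED — «WHICH CHILD BLOCKS AT ₁₂C» reads, for every presentation
of the record binding the world: six residual-carrier leaves, N09's four inputs, (S1ᵀ), (R₁₂) + (UV₁₂), and the two bounds on the merged β (lower `b > 0` UNPRINTED = NODE O; upper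
β⁺ [Balaban1987RG1] p. 264). [cite: Balaban1989LargeFieldII, Thm 1 p.355, (0.1) pp.355–356, p.387, p.391; Balaban1987RG1, (0.19) p.255, (1.20)–(1.22) p.264, (2.12)–(2.14) p.268, Thm 3 p.264, Lemma 4 (3.53) p.280; Balaban1988Convergent, Thm 1 p.262, Theorem p.245, p.244; Balaban1985Variational, Thm 1 p.279 (bookkeeping over the Stage-12 record)] -/
theorem N24_at_record₁₂C_knit_all_of_betaMerged_pinned (h : IsRecordOfRecord₁₂C F N D w)
    (slots₀₅ : ∀ (θ : Stage12Params F N) (hP : θ.Provisos₁₂ F N), θ.Admissible F N → D = datumOfRecord₁₂ F N θ hP →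
      (∀ P, w.up P = upOfRecord₅C F N (θ.toStage5₁₂ F N) P) → ∀ P : B12.RunParams,
        B8LeafR (θ.res.X P).d8 (θ.res.X P).L8 (θ.res.X P).C₂ (θ.res.X P).B₁' (θ.res.X P).B₀' (θ.res.X P).B₁ (θ.res.X P).B₂ (θ.res.X P).c₁
          (θ.res.X P).inp8 (θ.res.X P).B₀β (θ.res.X P).loc8 (θ.res.X P).fam8R (θ.res.X P).lan8 (θ.res.X P).cub8 (θ.res.X P).toAxial8)
    (slots₀₆ : ∀ (θ : Stage12Params F N) (hP : θ.Provisos₁₂ F N), θ.Admissible F N → D = datumOfRecord₁₂ F N θ hP →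
      (∀ P, w.up P = upOfRecord₅C F N (θ.toStage5₁₂ F N) P) → ∀ P : B12.RunParams, B9LeafX (θ.res.Y P))
    (slots₀₇ : ∀ (θ : Stage12Params F N) (hP : θ.Provisos₁₂ F N), θ.Admissible F N → D = datumOfRecord₁₂ F N θ hP →
      (∀ P, w.up P = upOfRecord₅C F N (θ.toStage5₁₂ F N) P) → ∀ P : B12.RunParams, B11Leaf (θ.res.Z P))
    (slots₀₈ : ∀ (θ : Stage12Params F N) (hP : θ.Provisos₁₂ F N), θ.Admissible F N → D = datumOfRecord₁₂ F N θ hP →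
      (∀ P, w.up P = upOfRecord₅C F N (θ.toStage5₁₂ F N) P) → ∀ P : B12.RunParams,
        ∃ (Xc : PrintedCarriersR) (I : Type) (C : B10Assembly.Consts) (T : I → B10.TowerRun),
          Nonempty (∀ i, B10Assembly.LeafSystem C (T i)) ∧ θ.res.X P = Xc.withTowerRuns10 T)
    (slot12 : ∀ (θ : Stage12Params F N) (hP : θ.Provisos₁₂ F N), θ.Admissible F N → D = datumOfRecord₁₂ F N θ hP → w.γ ≤ θ.γ →
      (∀ P, w.up P = upOfRecord₅C F N (θ.toStage5₁₂ F N) P) → ∀ P : B12.RunParams, B12Sec2to5.Lemma4Printed (θ.res.X P).F12 (θ.res.X P).c12)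
    (h11dom : ∀ (θ : Stage12Params F N) (hP : θ.Provisos₁₂ F N), θ.Admissible F N → D = datumOfRecord₁₂ F N θ hP → w.γ ≤ θ.γ →
      ∀ (p : B12.RunParams) (k : ℕ), k ≤ p.K →
        ∀ V ∈ domAltOfRecord F N θ.ν p.K k, UkExists F N p.K k θ.εbg V ∧ UniqueUkOrbit F N p.K k θ.εbg V)
    (hres : ∀ (θ : Stage12Params F N) (hP : θ.Provisos₁₂ F N), θ.Admissible F N → D = datumOfRecord₁₂ F N θ hP → w.γ ≤ θ.γ →
      ∀ (p : B12.RunParams) (k : ℕ), k ≤ p.K → HRestrict F N θ.εbg p.K k (domAltOfRecord F N θ.ν p.K k))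
    (huniq : ∀ (θ : Stage12Params F N) (hP : θ.Provisos₁₂ F N), θ.Admissible F N → D = datumOfRecord₁₂ F N θ hP → w.γ ≤ θ.γ →
      ∀ (p : B12.RunParams) (k : ℕ), k ≤ p.K → ∀ V ∈ domAltOfRecord F N θ.ν p.K k, ∀ j < k,
        UniqueUkOrbit F N p.K (j + 1) θ.εbg (Averaging.iter (avOfRecord F N p.K) (j + 1) (Uk F N p.K k θ.εbg V)))
    (slots₁₀ : ∀ (θ : Stage12Params F N) (hP : θ.Provisos₁₂ F N), θ.Admissible F N → D = datumOfRecord₁₂ F N θ hP →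
      (∀ P, w.up P = upOfRecord₅C F N (θ.toStage5₁₂ F N) P) → ∀ P : B12.RunParams,
        B9LeafX (θ.res.Y P) →
          (B10.Thm1PrintedCompact (θ.res.X P).runs10 ∧ B10.Thm2Printed (θ.res.X P).runs10) →
            B11Leaf (θ.res.Z P) → B12Sec2to5.Lemma4Printed (θ.res.X P).F12 (θ.res.X P).c12 →
              B13.Lemma1Printed (θ.res.X P).S13 (θ.res.X P).c13 ∧ B13.Lemma2Printed (θ.res.X P).S13 (θ.res.X P).c13 ∧
                B13.Lemma3Printed (θ.res.X P).S13 (θ.res.X P).c13)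
    (slot11 : ∀ (θ : Stage12Params F N) (hP : θ.Provisos₁₂ F N), θ.Admissible F N → D = datumOfRecord₁₂ F N θ hP →
      (∀ P, w.up P = upOfRecord₅C F N (θ.toStage5₁₂ F N) P) → ∀ P : B12.RunParams,
        (leavesP w P).b7 → (leavesP w P).b8 → (leavesP w P).b9 → (leavesP w P).b10 → (leavesP w P).b11 →
          (leavesP w P).smallCouplings → (leavesP w P).smallFieldInductive → (leavesP w P).flowControl →
            ∀ k, k < P.K → SLaw₁₂ F N θ P k → TLaw₁₂ F N θ P k)
    (slots₁₂ : ∀ (θ : Stage12Params F N) (hP : θ.Provisos₁₂ F N), θ.Admissible F N → D = datumOfRecord₁₂ F N θ hP →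
      (∀ P, w.up P = upOfRecord₅C F N (θ.toStage5₁₂ F N) P) → ∀ P : B12.RunParams, B15Leaf (θ.res.W P))
    (slots₁₃ : ∀ (θ : Stage12Params F N) (hP : θ.Provisos₁₂ F N), θ.Admissible F N → D = datumOfRecord₁₂ F N θ hP →
      (∀ P, w.up P = upOfRecord₅C F N (θ.toStage5₁₂ F N) P) → ∀ P : B12.RunParams,
        (∀ k, k < P.K → TLaw₁₂ F N θ P k → SLaw₁₂ F N θ P (k + 1)) ∧
        ((genFlow (betaOfRecord₁₀ F N θ.toStage9Params) P.g0).InInterval w.γ P.K → ∀ k, k ≤ P.K → SLaw₁₂ F N θ P k →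
          ∀ U : GaugeField (F.P P.K) k (SU N),
            chiFixed7 F N θ.ν P.K (gOfRecord₁₀ F N θ.toStage9Params P) k U *
                  Real.exp (-(1 / (gOfRecord₁₀ F N θ.toStage9Params P k) ^ 2 * wilsonBGOfRecord F N θ.εbg P k U)
                    - w.em (gOfRecord₁₀ F N θ.toStage9Params P k) * (Fintype.card (Site (F.P P.K) k) : ℝ)) ≤ densOfRecord₁₀ F N θ.toStage9Params P k U ∧
            densOfRecord₁₀ F N θ.toStage9Params P k U ≤ Real.exp (w.ep (gOfRecord₁₀ F N θ.toStage9Params P k) * (Fintype.card (Site (F.P P.K) k) : ℝ))))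
    (hβm : ∀ (θ : Stage12Params F N) (hP : θ.Provisos₁₂ F N), θ.Admissible F N → D = datumOfRecord₁₂ F N θ hP → w.γ ≤ θ.γ →
      letI := θ.instVβ₁; letI := θ.instVβ₂; letI := θ.instιβ
      BetaLowerH w.b w.γ (betaMerged F (mergedTermFamilyMatT F N (TcOfRecord F N) (chiFixed7 F N θ.ν) θ.εbg) θ.ρ8 θ.bV) ∧
        BetaUpperH w.βup w.γ (betaMerged F (mergedTermFamilyMatT F N (TcOfRecord F N) (chiFixed7 F N θ.ν) θ.εbg) θ.ρ8 θ.bV)) :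
    B16.EndStatementBPrinted D.C := by
  obtain ⟨θ, hP, hθ, hD, -, hγ, -, -⟩ := id h
  obtain ⟨hlo, hhi⟩ := hβm θ hP hθ hD hγ.2
  exact N24_at_record₁₂C_knit_all_pinned h le_rfl slots₀₅ slots₀₆ slots₀₇ slots₀₈ slot12 h11dom hres huniq slots₁₀ slot11 slots₁₂ slots₁₃
    ((N24_betaLowerH_iff_merged₁₂ θ hP hD hγ.2).mpr hlo) ((N24_betaUpperH_iff_merged₁₂ θ hP hD hγ.2).mpr hhi)

/-- **THE CONSEQUENT OF ITEM K1′ `StabilityBAtRecordR12e` IN ITS θ-KEYED SHAPE OF RECORD, REV 15, EVERY CHILD BY NAME** (module 28b's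
`N24_stabilityBR12e_thetaShape15_knit_N09_N11_pinned` with `hR` + `hcor3` ↦ `slots₁₃`; guard `hU : θ.ZtUnity F N ∧ θ.SlotsNondegenerate` DISPLAYED, K0′'s product; the window from
the upper box bound alone, module 26's `N24_window_of_betaUpperH`).  COMPOSITE: the item's body GIVEN the children; nothing is discharged.
[cite: Balaban1989LargeFieldII, Thm 1 p.355 + p.391; Balaban1988Convergent, (3.16)–(3.22) pp.268–269; Balaban1987RG1, Thm 3 p.264, (0.17)–(0.20) pp.255–256 and (1.22) p.264; Balaban1985Variational, Thm 1 p.279 (bookkeeping + elementary window)] -/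
theorem N24_stabilityBR12e_thetaShape15_knit_all_pinned (h : IsRecordOfRecord₁₂C F N D w) {γ₀ : ℝ} (hγ₀ : w.γ ≤ γ₀)
    (θ : Stage12Params F N) (hP : θ.Provisos₁₂ F N) (hθ : θ.Admissible F N) (hU : θ.ZtUnity F N ∧ θ.SlotsNondegenerate)
    (hD : D = datumOfRecord₁₂ F N θ hP)
    (slots₀₅ : ∀ (θ : Stage12Params F N) (hP : θ.Provisos₁₂ F N), θ.Admissible F N → D = datumOfRecord₁₂ F N θ hP →
      (∀ P, w.up P = upOfRecord₅C F N (θ.toStage5₁₂ F N) P) → ∀ P : B12.RunParams,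
        B8LeafR (θ.res.X P).d8 (θ.res.X P).L8 (θ.res.X P).C₂ (θ.res.X P).B₁' (θ.res.X P).B₀' (θ.res.X P).B₁ (θ.res.X P).B₂ (θ.res.X P).c₁
          (θ.res.X P).inp8 (θ.res.X P).B₀β (θ.res.X P).loc8 (θ.res.X P).fam8R (θ.res.X P).lan8 (θ.res.X P).cub8 (θ.res.X P).toAxial8)
    (slots₀₆ : ∀ (θ : Stage12Params F N) (hP : θ.Provisos₁₂ F N), θ.Admissible F N → D = datumOfRecord₁₂ F N θ hP →
      (∀ P, w.up P = upOfRecord₅C F N (θ.toStage5₁₂ F N) P) → ∀ P : B12.RunParams, B9LeafX (θ.res.Y P))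
    (slots₀₇ : ∀ (θ : Stage12Params F N) (hP : θ.Provisos₁₂ F N), θ.Admissible F N → D = datumOfRecord₁₂ F N θ hP →
      (∀ P, w.up P = upOfRecord₅C F N (θ.toStage5₁₂ F N) P) → ∀ P : B12.RunParams, B11Leaf (θ.res.Z P))
    (slots₀₈ : ∀ (θ : Stage12Params F N) (hP : θ.Provisos₁₂ F N), θ.Admissible F N → D = datumOfRecord₁₂ F N θ hP →
      (∀ P, w.up P = upOfRecord₅C F N (θ.toStage5₁₂ F N) P) → ∀ P : B12.RunParams,
        ∃ (Xc : PrintedCarriersR) (I : Type) (C : B10Assembly.Consts) (T : I → B10.TowerRun),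
          Nonempty (∀ i, B10Assembly.LeafSystem C (T i)) ∧ θ.res.X P = Xc.withTowerRuns10 T)
    (slot12 : ∀ (θ : Stage12Params F N) (hP : θ.Provisos₁₂ F N), θ.Admissible F N → D = datumOfRecord₁₂ F N θ hP → w.γ ≤ θ.γ →
      (∀ P, w.up P = upOfRecord₅C F N (θ.toStage5₁₂ F N) P) → ∀ P : B12.RunParams, B12Sec2to5.Lemma4Printed (θ.res.X P).F12 (θ.res.X P).c12)
    (h11dom : ∀ (θ : Stage12Params F N) (hP : θ.Provisos₁₂ F N), θ.Admissible F N → D = datumOfRecord₁₂ F N θ hP → w.γ ≤ θ.γ →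
      ∀ (p : B12.RunParams) (k : ℕ), k ≤ p.K →
        ∀ V ∈ domAltOfRecord F N θ.ν p.K k, UkExists F N p.K k θ.εbg V ∧ UniqueUkOrbit F N p.K k θ.εbg V)
    (hres : ∀ (θ : Stage12Params F N) (hP : θ.Provisos₁₂ F N), θ.Admissible F N → D = datumOfRecord₁₂ F N θ hP → w.γ ≤ θ.γ →
      ∀ (p : B12.RunParams) (k : ℕ), k ≤ p.K → HRestrict F N θ.εbg p.K k (domAltOfRecord F N θ.ν p.K k))
    (huniq : ∀ (θ : Stage12Params F N) (hP : θ.Provisos₁₂ F N), θ.Admissible F N → D = datumOfRecord₁₂ F N θ hP → w.γ ≤ θ.γ →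
      ∀ (p : B12.RunParams) (k : ℕ), k ≤ p.K → ∀ V ∈ domAltOfRecord F N θ.ν p.K k, ∀ j < k,
        UniqueUkOrbit F N p.K (j + 1) θ.εbg (Averaging.iter (avOfRecord F N p.K) (j + 1) (Uk F N p.K k θ.εbg V)))
    (slots₁₀ : ∀ (θ : Stage12Params F N) (hP : θ.Provisos₁₂ F N), θ.Admissible F N → D = datumOfRecord₁₂ F N θ hP →
      (∀ P, w.up P = upOfRecord₅C F N (θ.toStage5₁₂ F N) P) → ∀ P : B12.RunParams,
        B9LeafX (θ.res.Y P) →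
          (B10.Thm1PrintedCompact (θ.res.X P).runs10 ∧ B10.Thm2Printed (θ.res.X P).runs10) →
            B11Leaf (θ.res.Z P) → B12Sec2to5.Lemma4Printed (θ.res.X P).F12 (θ.res.X P).c12 →
              B13.Lemma1Printed (θ.res.X P).S13 (θ.res.X P).c13 ∧ B13.Lemma2Printed (θ.res.X P).S13 (θ.res.X P).c13 ∧
                B13.Lemma3Printed (θ.res.X P).S13 (θ.res.X P).c13)
    (slot11 : ∀ (θ : Stage12Params F N) (hP : θ.Provisos₁₂ F N), θ.Admissible F N → D = datumOfRecord₁₂ F N θ hP →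
      (∀ P, w.up P = upOfRecord₅C F N (θ.toStage5₁₂ F N) P) → ∀ P : B12.RunParams,
        (leavesP w P).b7 → (leavesP w P).b8 → (leavesP w P).b9 → (leavesP w P).b10 → (leavesP w P).b11 →
          (leavesP w P).smallCouplings → (leavesP w P).smallFieldInductive → (leavesP w P).flowControl →
            ∀ k, k < P.K → SLaw₁₂ F N θ P k → TLaw₁₂ F N θ P k)
    (slots₁₂ : ∀ (θ : Stage12Params F N) (hP : θ.Provisos₁₂ F N), θ.Admissible F N → D = datumOfRecord₁₂ F N θ hP →
      (∀ P, w.up P = upOfRecord₅C F N (θ.toStage5₁₂ F N) P) → ∀ P : B12.RunParams, B15Leaf (θ.res.W P))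
    (slots₁₃ : ∀ (θ : Stage12Params F N) (hP : θ.Provisos₁₂ F N), θ.Admissible F N → D = datumOfRecord₁₂ F N θ hP →
      (∀ P, w.up P = upOfRecord₅C F N (θ.toStage5₁₂ F N) P) → ∀ P : B12.RunParams,
        (∀ k, k < P.K → TLaw₁₂ F N θ P k → SLaw₁₂ F N θ P (k + 1)) ∧
        ((genFlow (betaOfRecord₁₀ F N θ.toStage9Params) P.g0).InInterval w.γ P.K → ∀ k, k ≤ P.K → SLaw₁₂ F N θ P k →
          ∀ U : GaugeField (F.P P.K) k (SU N),
            chiFixed7 F N θ.ν P.K (gOfRecord₁₀ F N θ.toStage9Params P) k U *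
                  Real.exp (-(1 / (gOfRecord₁₀ F N θ.toStage9Params P k) ^ 2 * wilsonBGOfRecord F N θ.εbg P k U)
                    - w.em (gOfRecord₁₀ F N θ.toStage9Params P k) * (Fintype.card (Site (F.P P.K) k) : ℝ)) ≤ densOfRecord₁₀ F N θ.toStage9Params P k U ∧
            densOfRecord₁₀ F N θ.toStage9Params P k U ≤ Real.exp (w.ep (gOfRecord₁₀ F N θ.toStage9Params P k) * (Fintype.card (Site (F.P P.K) k) : ℝ))))
    (hlo : BetaLowerH w.b γ₀ D.βfun) (hhi : BetaUpperH w.βup γ₀ D.βfun) :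
    ∃ (θ' : Stage12Params F N) (h' : θ'.Provisos₁₂ F N), (θ'.ZtUnity F N ∧ θ'.SlotsNondegenerate) ∧ θ'.Admissible F N ∧
      B16.EndStatementBPrinted (datumOfRecord₁₂ F N θ' h').C ∧
      ∃ γ₁ : ℝ, 0 < γ₁ ∧ ∀ γ : ℝ, 0 < γ → γ ≤ γ₁ → ∃ P : B12.RunParams, 1 ≤ P.K ∧ ((datumOfRecord₁₂ F N θ' h').C P).flow.InInterval γ P.K := by
  have hB := N24_at_record₁₂C_knit_all_pinned h hγ₀ slots₀₅ slots₀₆ slots₀₇ slots₀₈ slot12 h11dom hres huniq slots₁₀ slot11 slots₁₂ slots₁₃ hlo hhi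
  have hW := N24_window_of_betaUpperH D (lt_of_lt_of_le (gamma_pos_of_isRecordOfRecord₁₂C h) hγ₀) hhi
  subst hD
  exact ⟨θ, hP, hU, hθ, hB, hW⟩

/-! ## §2. The thirteen nodes AT THE RECORD'S OWN WORLD, every child by name (the `stub_nodes12` consequent with no world-level hypothesis and no exponent re-read) -/

/-- **N24 · THE THIRTEEN DAG NODES AT THE WORLD OF A STAGE-12 RECORD ITSELF, EVERY CHILD BY NAME** (module 28b's `N24_nodes₁₂C_knit_N09_N11_pinned` with `hR` + `hcor3` ↦ `slots₁₃`):
N01 ∕ N02 ∕ N04 def-T's transferred theorems, N03 module 23's, six θ-keyed residual-carrier sockets, **N09** ← `slot12` + `h11dom` + `hres` + `huniq`, **N11** ← `slot11`, **N13** ←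
`slots₁₃` ⇒ `∀ P, Nodes (leavesP w P)` — AT `w`, because (UV₁₂) is read at the world's own `(e₋, e₊)` (module 26 needed «∃ (e₋, e₊), … { w with em, ep }» only because the Cor.-3 leaves
name their own dependence functions).  THE HYPOTHESIS LIST IS «WHICH CHILD BLOCKS `stub_nodes12` AT A ₁₂C RECORD» WITH NO WORLD-LEVEL NODE HYPOTHESIS.
[cite: Balaban1989LargeFieldII, Thm 1 p.355, (0.1) pp.355–356, p.387, p.391; Balaban1988Convergent, Thm 1 p.262, Theorem p.245, p.244, (2.18) p.257, Cor. 3 (2.50) p.264; Balaban1987RG1, Thm 1 p.259, Thm 3 p.264, Lemma 4 (3.53) p.280, (1.1)–(1.3) p.260; Balaban1985Variational, Thm 1 (8)–(10) p.279; Balaban1985RegularSpaces, Thms 2, 4, 8 pp.83–101; Balaban1985BackgroundPropagators, Thms 3.1–3.15 pp.397–432; Balaban1985UV3, Thm 1 p.257 + Thm 2 p.272; Balaban1988RG2Cluster, Lemmas 1–3 pp.9, 11, 20; Balaban1989LargeFieldI, Prop. 1 p.194; Balaban1983RegularityDecay, Theorem p.573; Balaban1984PropagatorsI, Props. 1.1–1.2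 pp.33–36; Balaban1984PropagatorsII, pp.234–249; Balaban1985Averaging, Props. 1–10 pp.26–50 (bookkeeping over the Stage-12 record)] -/
theorem N24_nodes₁₂C_knit_all_pinned (h : IsRecordOfRecord₁₂C F N D w)
    (slots₀₅ : ∀ (θ : Stage12Params F N) (hP : θ.Provisos₁₂ F N), θ.Admissible F N → D = datumOfRecord₁₂ F N θ hP →
      (∀ P, w.up P = upOfRecord₅C F N (θ.toStage5₁₂ F N) P) → ∀ P : B12.RunParams,
        B8LeafR (θ.res.X P).d8 (θ.res.X P).L8 (θ.res.X P).C₂ (θ.res.X P).B₁' (θ.res.X P).B₀' (θ.res.X P).B₁ (θ.res.X P).B₂ (θ.res.X P).c₁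
          (θ.res.X P).inp8 (θ.res.X P).B₀β (θ.res.X P).loc8 (θ.res.X P).fam8R (θ.res.X P).lan8 (θ.res.X P).cub8 (θ.res.X P).toAxial8)
    (slots₀₆ : ∀ (θ : Stage12Params F N) (hP : θ.Provisos₁₂ F N), θ.Admissible F N → D = datumOfRecord₁₂ F N θ hP →
      (∀ P, w.up P = upOfRecord₅C F N (θ.toStage5₁₂ F N) P) → ∀ P : B12.RunParams, B9LeafX (θ.res.Y P))
    (slots₀₇ : ∀ (θ : Stage12Params F N) (hP : θ.Provisos₁₂ F N), θ.Admissible F N → D = datumOfRecord₁₂ F N θ hP →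
      (∀ P, w.up P = upOfRecord₅C F N (θ.toStage5₁₂ F N) P) → ∀ P : B12.RunParams, B11Leaf (θ.res.Z P))
    (slots₀₈ : ∀ (θ : Stage12Params F N) (hP : θ.Provisos₁₂ F N), θ.Admissible F N → D = datumOfRecord₁₂ F N θ hP →
      (∀ P, w.up P = upOfRecord₅C F N (θ.toStage5₁₂ F N) P) → ∀ P : B12.RunParams,
        ∃ (Xc : PrintedCarriersR) (I : Type) (C : B10Assembly.Consts) (T : I → B10.TowerRun),
          Nonempty (∀ i, B10Assembly.LeafSystem C (T i)) ∧ θ.res.X P = Xc.withTowerRuns10 T)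
    (slot12 : ∀ (θ : Stage12Params F N) (hP : θ.Provisos₁₂ F N), θ.Admissible F N → D = datumOfRecord₁₂ F N θ hP → w.γ ≤ θ.γ →
      (∀ P, w.up P = upOfRecord₅C F N (θ.toStage5₁₂ F N) P) → ∀ P : B12.RunParams, B12Sec2to5.Lemma4Printed (θ.res.X P).F12 (θ.res.X P).c12)
    (h11dom : ∀ (θ : Stage12Params F N) (hP : θ.Provisos₁₂ F N), θ.Admissible F N → D = datumOfRecord₁₂ F N θ hP → w.γ ≤ θ.γ →
      ∀ (p : B12.RunParams) (k : ℕ), k ≤ p.K →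
        ∀ V ∈ domAltOfRecord F N θ.ν p.K k, UkExists F N p.K k θ.εbg V ∧ UniqueUkOrbit F N p.K k θ.εbg V)
    (hres : ∀ (θ : Stage12Params F N) (hP : θ.Provisos₁₂ F N), θ.Admissible F N → D = datumOfRecord₁₂ F N θ hP → w.γ ≤ θ.γ →
      ∀ (p : B12.RunParams) (k : ℕ), k ≤ p.K → HRestrict F N θ.εbg p.K k (domAltOfRecord F N θ.ν p.K k))
    (huniq : ∀ (θ : Stage12Params F N) (hP : θ.Provisos₁₂ F N), θ.Admissible F N → D = datumOfRecord₁₂ F N θ hP → w.γ ≤ θ.γ →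
      ∀ (p : B12.RunParams) (k : ℕ), k ≤ p.K → ∀ V ∈ domAltOfRecord F N θ.ν p.K k, ∀ j < k,
        UniqueUkOrbit F N p.K (j + 1) θ.εbg (Averaging.iter (avOfRecord F N p.K) (j + 1) (Uk F N p.K k θ.εbg V)))
    (slots₁₀ : ∀ (θ : Stage12Params F N) (hP : θ.Provisos₁₂ F N), θ.Admissible F N → D = datumOfRecord₁₂ F N θ hP →
      (∀ P, w.up P = upOfRecord₅C F N (θ.toStage5₁₂ F N) P) → ∀ P : B12.RunParams,
        B9LeafX (θ.res.Y P) →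
          (B10.Thm1PrintedCompact (θ.res.X P).runs10 ∧ B10.Thm2Printed (θ.res.X P).runs10) →
            B11Leaf (θ.res.Z P) → B12Sec2to5.Lemma4Printed (θ.res.X P).F12 (θ.res.X P).c12 →
              B13.Lemma1Printed (θ.res.X P).S13 (θ.res.X P).c13 ∧ B13.Lemma2Printed (θ.res.X P).S13 (θ.res.X P).c13 ∧
                B13.Lemma3Printed (θ.res.X P).S13 (θ.res.X P).c13)
    (slot11 : ∀ (θ : Stage12Params F N) (hP : θ.Provisos₁₂ F N), θ.Admissible F N → D = datumOfRecord₁₂ F N θ hP →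
      (∀ P, w.up P = upOfRecord₅C F N (θ.toStage5₁₂ F N) P) → ∀ P : B12.RunParams,
        (leavesP w P).b7 → (leavesP w P).b8 → (leavesP w P).b9 → (leavesP w P).b10 → (leavesP w P).b11 →
          (leavesP w P).smallCouplings → (leavesP w P).smallFieldInductive → (leavesP w P).flowControl →
            ∀ k, k < P.K → SLaw₁₂ F N θ P k → TLaw₁₂ F N θ P k)
    (slots₁₂ : ∀ (θ : Stage12Params F N) (hP : θ.Provisos₁₂ F N), θ.Admissible F N → D = datumOfRecord₁₂ F N θ hP →
      (∀ P, w.up P = upOfRecord₅C F N (θ.toStage5₁₂ F N) P) → ∀ P : B12.RunParams, B15Leaf (θ.res.W P))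
    (slots₁₃ : ∀ (θ : Stage12Params F N) (hP : θ.Provisos₁₂ F N), θ.Admissible F N → D = datumOfRecord₁₂ F N θ hP →
      (∀ P, w.up P = upOfRecord₅C F N (θ.toStage5₁₂ F N) P) → ∀ P : B12.RunParams,
        (∀ k, k < P.K → TLaw₁₂ F N θ P k → SLaw₁₂ F N θ P (k + 1)) ∧
        ((genFlow (betaOfRecord₁₀ F N θ.toStage9Params) P.g0).InInterval w.γ P.K → ∀ k, k ≤ P.K → SLaw₁₂ F N θ P k →
          ∀ U : GaugeField (F.P P.K) k (SU N),
            chiFixed7 F N θ.ν P.K (gOfRecord₁₀ F N θ.toStage9Params P) k U *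
                  Real.exp (-(1 / (gOfRecord₁₀ F N θ.toStage9Params P k) ^ 2 * wilsonBGOfRecord F N θ.εbg P k U)
                    - w.em (gOfRecord₁₀ F N θ.toStage9Params P k) * (Fintype.card (Site (F.P P.K) k) : ℝ)) ≤ densOfRecord₁₀ F N θ.toStage9Params P k U ∧
            densOfRecord₁₀ F N θ.toStage9Params P k U ≤ Real.exp (w.ep (gOfRecord₁₀ F N θ.toStage9Params P k) * (Fintype.card (Site (F.P P.K) k) : ℝ)))) :
    ∀ P : B12.RunParams, Nodes (leavesP w P) := fun P =>
  ⟨b4_main_of_isRecordOfRecord₁₂C h P, b5_main_of_isRecordOfRecord₁₂C h P, N24_b6_main_of_isRecordOfRecord₁₂C h P, b7_main_of_isRecordOfRecord₁₂C h P,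
    N24_b8_main_of_isRecordOfRecord₁₂C_of_slot h slots₀₅ P, N24_b9_main_of_isRecordOfRecord₁₂C_of_slot h slots₀₆ P,
    N24_b10_main_of_isRecordOfRecord₁₂C_of_slot h slots₀₈ P, N24_b11_main_of_isRecordOfRecord₁₂C_of_slot h slots₀₇ P,
    N24_b12_main_of_isRecordOfRecord₁₂C_of_slots h slot12 h11dom hres huniq P, N24_b13_main_of_isRecordOfRecord₁₂C_of_slot h slots₁₀ P,
    N24_b14_main_of_isRecordOfRecord₁₂C_of_slot h slot11 P, N24_b15_main_of_isRecordOfRecord₁₂C_of_slot h slots₁₂ P,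
    N24_b16_main_of_isRecordOfRecord₁₂C_of_slots h slots₁₃ P⟩

/-- **THE BODY OF `NodesAtSomeRecord12` WITNESSED BY THE PRESENTATION AND THE WORLD AT HAND, EVERY CHILD BY NAME** (module 26's `N24_nodesAtRecord₁₂_thetaShape_knit_N11_pinned` with
`h09` ∕ `hR` ∕ `hcor3` ↦ §2's keyed binders): a guarded admissible presentation `(θ, hP)` (`hU` DISPLAYED — K0′'s product, not discharged here), a world `w` of its datum of record and
§2's children give `∃ θ' h' w', (θ'.ZtUnity ∧ θ'.SlotsNondegenerate) ∧ θ'.Admissible ∧ IsRecordOfRecord₁₂C F N (datumOfRecord₁₂ F N θ' h') w' ∧ ∀ P, Nodes (leavesP w' P)` — witnesses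
`(θ, hP, w)` THEMSELVES (no re-read).  COMPOSITE: the stub's consequent GIVEN the children; nothing is discharged.
[cite: Balaban1989LargeFieldII, Thm 1 p.355, (0.1) pp.355–356, p.391; Balaban1988Convergent, Thm 1 p.262, Cor. 3 (2.50) p.264; Balaban1987RG1, Thm 3 p.264; Balaban1985Variational, Thm 1 p.279 (bookkeeping)] -/
theorem N24_nodesAtRecord₁₂_thetaShape_knit_all_pinned (h : IsRecordOfRecord₁₂C F N D w)
    (θ : Stage12Params F N) (hP : θ.Provisos₁₂ F N) (hθ : θ.Admissible F N) (hU : θ.ZtUnity F N ∧ θ.SlotsNondegenerate)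
    (hD : D = datumOfRecord₁₂ F N θ hP)
    (slots₀₅ : ∀ (θ : Stage12Params F N) (hP : θ.Provisos₁₂ F N), θ.Admissible F N → D = datumOfRecord₁₂ F N θ hP →
      (∀ P, w.up P = upOfRecord₅C F N (θ.toStage5₁₂ F N) P) → ∀ P : B12.RunParams,
        B8LeafR (θ.res.X P).d8 (θ.res.X P).L8 (θ.res.X P).C₂ (θ.res.X P).B₁' (θ.res.X P).B₀' (θ.res.X P).B₁ (θ.res.X P).B₂ (θ.res.X P).c₁
          (θ.res.X P).inp8 (θ.res.X P).B₀β (θ.res.X P).loc8 (θ.res.X P).fam8R (θ.res.X P).lan8 (θ.res.X P).cub8 (θ.res.X P).toAxial8)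
    (slots₀₆ : ∀ (θ : Stage12Params F N) (hP : θ.Provisos₁₂ F N), θ.Admissible F N → D = datumOfRecord₁₂ F N θ hP →
      (∀ P, w.up P = upOfRecord₅C F N (θ.toStage5₁₂ F N) P) → ∀ P : B12.RunParams, B9LeafX (θ.res.Y P))
    (slots₀₇ : ∀ (θ : Stage12Params F N) (hP : θ.Provisos₁₂ F N), θ.Admissible F N → D = datumOfRecord₁₂ F N θ hP →
      (∀ P, w.up P = upOfRecord₅C F N (θ.toStage5₁₂ F N) P) → ∀ P : B12.RunParams, B11Leaf (θ.res.Z P))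
    (slots₀₈ : ∀ (θ : Stage12Params F N) (hP : θ.Provisos₁₂ F N), θ.Admissible F N → D = datumOfRecord₁₂ F N θ hP →
      (∀ P, w.up P = upOfRecord₅C F N (θ.toStage5₁₂ F N) P) → ∀ P : B12.RunParams,
        ∃ (Xc : PrintedCarriersR) (I : Type) (C : B10Assembly.Consts) (T : I → B10.TowerRun),
          Nonempty (∀ i, B10Assembly.LeafSystem C (T i)) ∧ θ.res.X P = Xc.withTowerRuns10 T)
    (slot12 : ∀ (θ : Stage12Params F N) (hP : θ.Provisos₁₂ F N), θ.Admissible F N → D = datumOfRecord₁₂ F N θ hP → w.γ ≤ θ.γ →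
      (∀ P, w.up P = upOfRecord₅C F N (θ.toStage5₁₂ F N) P) → ∀ P : B12.RunParams, B12Sec2to5.Lemma4Printed (θ.res.X P).F12 (θ.res.X P).c12)
    (h11dom : ∀ (θ : Stage12Params F N) (hP : θ.Provisos₁₂ F N), θ.Admissible F N → D = datumOfRecord₁₂ F N θ hP → w.γ ≤ θ.γ →
      ∀ (p : B12.RunParams) (k : ℕ), k ≤ p.K →
        ∀ V ∈ domAltOfRecord F N θ.ν p.K k, UkExists F N p.K k θ.εbg V ∧ UniqueUkOrbit F N p.K k θ.εbg V)
    (hres : ∀ (θ : Stage12Params F N) (hP : θ.Provisos₁₂ F N), θ.Admissible F N → D = datumOfRecord₁₂ F N θ hP → w.γ ≤ θ.γ →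
      ∀ (p : B12.RunParams) (k : ℕ), k ≤ p.K → HRestrict F N θ.εbg p.K k (domAltOfRecord F N θ.ν p.K k))
    (huniq : ∀ (θ : Stage12Params F N) (hP : θ.Provisos₁₂ F N), θ.Admissible F N → D = datumOfRecord₁₂ F N θ hP → w.γ ≤ θ.γ →
      ∀ (p : B12.RunParams) (k : ℕ), k ≤ p.K → ∀ V ∈ domAltOfRecord F N θ.ν p.K k, ∀ j < k,
        UniqueUkOrbit F N p.K (j + 1) θ.εbg (Averaging.iter (avOfRecord F N p.K) (j + 1) (Uk F N p.K k θ.εbg V)))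
    (slots₁₀ : ∀ (θ : Stage12Params F N) (hP : θ.Provisos₁₂ F N), θ.Admissible F N → D = datumOfRecord₁₂ F N θ hP →
      (∀ P, w.up P = upOfRecord₅C F N (θ.toStage5₁₂ F N) P) → ∀ P : B12.RunParams,
        B9LeafX (θ.res.Y P) →
          (B10.Thm1PrintedCompact (θ.res.X P).runs10 ∧ B10.Thm2Printed (θ.res.X P).runs10) →
            B11Leaf (θ.res.Z P) → B12Sec2to5.Lemma4Printed (θ.res.X P).F12 (θ.res.X P).c12 →
              B13.Lemma1Printed (θ.res.X P).S13 (θ.res.X P).c13 ∧ B13.Lemma2Printed (θ.res.X P).S13 (θ.res.X P).c13 ∧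
                B13.Lemma3Printed (θ.res.X P).S13 (θ.res.X P).c13)
    (slot11 : ∀ (θ : Stage12Params F N) (hP : θ.Provisos₁₂ F N), θ.Admissible F N → D = datumOfRecord₁₂ F N θ hP →
      (∀ P, w.up P = upOfRecord₅C F N (θ.toStage5₁₂ F N) P) → ∀ P : B12.RunParams,
        (leavesP w P).b7 → (leavesP w P).b8 → (leavesP w P).b9 → (leavesP w P).b10 → (leavesP w P).b11 →
          (leavesP w P).smallCouplings → (leavesP w P).smallFieldInductive → (leavesP w P).flowControl →
            ∀ k, k < P.K → SLaw₁₂ F N θ P k → TLaw₁₂ F N θ P k)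
    (slots₁₂ : ∀ (θ : Stage12Params F N) (hP : θ.Provisos₁₂ F N), θ.Admissible F N → D = datumOfRecord₁₂ F N θ hP →
      (∀ P, w.up P = upOfRecord₅C F N (θ.toStage5₁₂ F N) P) → ∀ P : B12.RunParams, B15Leaf (θ.res.W P))
    (slots₁₃ : ∀ (θ : Stage12Params F N) (hP : θ.Provisos₁₂ F N), θ.Admissible F N → D = datumOfRecord₁₂ F N θ hP →
      (∀ P, w.up P = upOfRecord₅C F N (θ.toStage5₁₂ F N) P) → ∀ P : B12.RunParams,
        (∀ k, k < P.K → TLaw₁₂ F N θ P k → SLaw₁₂ F N θ P (k + 1)) ∧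
        ((genFlow (betaOfRecord₁₀ F N θ.toStage9Params) P.g0).InInterval w.γ P.K → ∀ k, k ≤ P.K → SLaw₁₂ F N θ P k →
          ∀ U : GaugeField (F.P P.K) k (SU N),
            chiFixed7 F N θ.ν P.K (gOfRecord₁₀ F N θ.toStage9Params P) k U *
                  Real.exp (-(1 / (gOfRecord₁₀ F N θ.toStage9Params P k) ^ 2 * wilsonBGOfRecord F N θ.εbg P k U)
                    - w.em (gOfRecord₁₀ F N θ.toStage9Params P k) * (Fintype.card (Site (F.P P.K) k) : ℝ)) ≤ densOfRecord₁₀ F N θ.toStage9Params P k U ∧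
            densOfRecord₁₀ F N θ.toStage9Params P k U ≤ Real.exp (w.ep (gOfRecord₁₀ F N θ.toStage9Params P k) * (Fintype.card (Site (F.P P.K) k) : ℝ)))) :
    ∃ (θ' : Stage12Params F N) (h' : θ'.Provisos₁₂ F N) (w' : WorldP), (θ'.ZtUnity F N ∧ θ'.SlotsNondegenerate) ∧ θ'.Admissible F N ∧
      IsRecordOfRecord₁₂C F N (datumOfRecord₁₂ F N θ' h') w' ∧ ∀ P : B12.RunParams, Nodes (leavesP w' P) := by
  have hn := N24_nodes₁₂C_knit_all_pinned h slots₀₅ slots₀₆ slots₀₇ slots₀₈ slot12 h11dom hres huniq slots₁₀ slot11 slots₁₂ slots₁₃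
  subst hD
  exact ⟨θ, hP, w, hU, hθ, h, hn⟩

end Literature.MathematicalPhysics.QuantumFieldTheory.Balaban1983to89.Node00

end
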